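import Mathlib
import HarnessLib

/-!
# Rhin–Viola 2001, Theorem 3.1 — I: circle integrals of Laurent polynomials (the residue bookkeeping)

Topic `Literature/NumberTheory/Irrationality/RhinViola2001`. First file (cell `pub-zeta5`, seat ct-1 g35, 2026-08-28)
towards DISCHARGING the named fact `theorem31` of `GroupStructure.lean`: G. Rhin, C. Viola, *The group structure for
ζ(3)*, Acta Arith. **97** (2001) 269–293 [RhinViola2001], **Lemma 3.1 and Theorem 3.1** (pp. 276–279) — the triple
contour integral `Ĩ(h,j,k,l,m,q,r,s) = (2πi)⁻³ ∮_{|x|=ρ₁} ∮_{|y−1/x|=ρ₂} ∮_{|z−1/(1−xy)|=ρ₃}` of the integrand of (2.1)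
"is the integer `b`" of `I = a + 2bζ(3)` (Theorem 2.1).

The printed proof deforms non-concentric contours and transports the birational map `ϑ` through them (Lemma 3.1),
then invokes the irrationality of `ζ(3)`. The tree's proof (files `Contour*Proofs.lean`, `Theorem31Proofs.lean`)
instead EVALUATES `Ĩ` in closed form: at each of the three levels the integrand is a Laurent polynomial in
(variable − centre) — `1 − (1−xy)z = −(1−xy)·(z − (1−xy)⁻¹)`, `1 − xy = −x·(y − x⁻¹)` — so that each circle
integral is the elementary residue `∮_{|z−c|=R} (z−c)ⁿ dz = 2πi·[n = −1]` (Mathlib: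
`circleIntegral.integral_sub_zpow_of_ne`, `circleIntegral.integral_sub_center_inv`).

This file holds the generic, parameter-free part (everything PROVED, no definition, no named fact):

* `circleIntegral_sub_zpow_ite` — `∮_{|z−c|=R} (z−c)ⁿ dz = 2πi` if `n = −1` and `0` otherwise (`R > 0`);
* `circleIntegral_eval_mul_zpow_negSucc` — for a polynomial `p`:
  `∮_{|z−c|=R} p(z)·(z−c)^{−(N+1)} dz = 2πi · (N-th Taylor coefficient of p at c)`;
* `circleIntegral_eval_eq_zero`, `circleIntegral_eval_mul_pow_eq_zero` — a polynomial integrates to `0`;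
* `taylor_coeff_X_pow_mul_one_sub_X_pow` — the Taylor coefficients of `X^j (1−X)^q` at `c` as the explicit
  binomial convolution `Σ_{a+b=N} C(j,a) c^{j−a} · C(q,b) (−1)^b (1−c)^{q−b}` (the source of every binomial
  coefficient in the closed form of `Ĩ`).

HONEST FRAMING (cell pub-zeta5): elementary residues of rational functions; nothing here concerns `ζ(5)` or the
irrationality of `ζ(3)`; records in print unmoved.
-/

noncomputable section

namespace Literature.NumberTheory.Irrationality.RhinViola2001

namespace Theorem31

open Complex MeasureTheory Polynomial Finset Metric Set

/-! ### Circle integrals of the monomials `(z − c)ⁿ` -/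

/-- The centre of a circle of positive radius does not lie on it (plumbing). [folklore] -/
private theorem center_not_mem_sphere_abs (c : ℂ) {R : ℝ} (hR : 0 < R) : c ∉ sphere c |R| := by
  rw [mem_sphere, dist_self, abs_of_pos hR]
  exact ne_of_lt hR

/-- A point of a circle of positive radius differs from the centre (plumbing). [cite: RhinViola2001, §3 (3.1) p. 276 (the contours avoid the poles)] -/
theorem sub_center_ne_zero_of_mem_sphere {c z : ℂ} {R : ℝ} (hR : 0 < R) (hz : z ∈ sphere c R) : z - c ≠ 0 := by
  rw [sub_ne_zero]
  rintro rfl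
  rw [mem_sphere, dist_self] at hz
  exact (ne_of_lt hR) hz

/-- `a · (z − c)ⁿ` is circle integrable on `|z − c| = R`, `R > 0`, for every integer `n` (Mathlib's
`circleIntegrable_sub_zpow_iff`: the only obstruction is a pole ON the circle). [cite: RhinViola2001, §3 (3.1) p. 276] -/
theorem circleIntegrable_const_mul_sub_zpow (a c : ℂ) {R : ℝ} (hR : 0 < R) (n : ℤ) :
    CircleIntegrable (fun z => a * (z - c) ^ n) c R := by
  have h : CircleIntegrable (fun z => (z - c) ^ n) c R :=
    circleIntegrable_sub_zpow_iff.2 (Or.inr (Or.inr (center_not_mem_sphere_abs c hR)))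
  simpa only [smul_eq_mul] using h.const_fun_smul (a := a)

/-- The elementary residue: `∮_{|z−c|=R} (z−c)ⁿ dz = 2πi` if `n = −1` and `= 0` otherwise (`R > 0`).
[cite: RhinViola2001, §3 (3.9)–(3.10) p. 279] -/
theorem circleIntegral_sub_zpow_ite (c : ℂ) {R : ℝ} (hR : 0 < R) (n : ℤ) :
    (∮ z in C(c, R), (z - c) ^ n) = if n = -1 then 2 * Real.pi * I else 0 := by
  split_ifs with h
  · subst h
    simp only [zpow_neg, zpow_one]
    exact circleIntegral.integral_sub_center_inv c hR.ne'
  · exact circleIntegral.integral_sub_zpow_of_ne h c c R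

/-- A finite Laurent sum integrates to `2πi` times the sum of its coefficients of `(z−c)⁻¹`:
`∮_{|z−c|=R} Σᵢ aᵢ (z−c)^{eᵢ} dz = 2πi · Σ_{i : eᵢ = −1} aᵢ`. [cite: RhinViola2001, §3 (3.9)–(3.10) p. 279] -/
theorem circleIntegral_sum_mul_sub_zpow {ι : Type*} (s : Finset ι) (a : ι → ℂ) (e : ι → ℤ) (c : ℂ) {R : ℝ}
    (hR : 0 < R) :
    (∮ z in C(c, R), ∑ i ∈ s, a i * (z - c) ^ e i) =
      2 * Real.pi * I * ∑ i ∈ s, if e i = -1 then a i else 0 := by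
  rw [circleIntegral.integral_fun_sum (fun i _ => circleIntegrable_const_mul_sub_zpow (a i) c hR (e i)),
    Finset.mul_sum]
  refine sum_congr rfl fun i _ => ?_
  rw [circleIntegral.integral_const_mul, circleIntegral_sub_zpow_ite c hR]
  split_ifs <;> ring

/-! ### Polynomial numerators -/

/-- **Residue with a polynomial numerator**: for a polynomial `p`, a centre `c`, a radius `R > 0` and `N ∈ ℕ`,
`∮_{|z−c|=R} p(z) (z−c)^{−(N+1)} dz = 2πi · (taylor c p).coeff N` — the `N`-th Taylor coefficient of `p` at
`c`, i.e. `p^{(N)}(c)/N!` (Cauchy's formula for derivatives, here for polynomials by expanding `p` at `c`).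
[cite: RhinViola2001, §3 (3.9)–(3.10) p. 279] -/
theorem circleIntegral_eval_mul_zpow_negSucc (p : ℂ[X]) (c : ℂ) {R : ℝ} (hR : 0 < R) (N : ℕ) :
    (∮ z in C(c, R), p.eval z * (z - c) ^ (-((N : ℤ) + 1))) =
      2 * Real.pi * I * (taylor c p).coeff N := by
  set q : ℂ[X] := taylor c p with hq
  have h1 : EqOn (fun z => p.eval z * (z - c) ^ (-((N : ℤ) + 1)))
      (fun z => ∑ i ∈ range (q.natDegree + 1), q.coeff i * (z - c) ^ ((i : ℤ) + -((N : ℤ) + 1)))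
      (sphere c R) := by
    intro z hz
    have hzc : z - c ≠ 0 := sub_center_ne_zero_of_mem_sphere hR hz
    simp only
    rw [← taylor_eval_sub c p z, eval_eq_sum_range, Finset.sum_mul]
    refine sum_congr rfl fun i _ => ?_
    rw [mul_assoc, ← zpow_natCast, ← zpow_add₀ hzc]
  rw [circleIntegral.integral_congr hR.le h1, circleIntegral_sum_mul_sub_zpow _ _ _ c hR]
  congr 1
  have h2 : ∀ i ∈ range (q.natDegree + 1),
      (if (i : ℤ) + -((N : ℤ) + 1) = -1 then q.coeff i else 0) = if N = i then q.coeff i else 0 := by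
    intro i _
    by_cases h : N = i
    · subst h; simp
    · have h' : ¬ ((i : ℤ) + -((N : ℤ) + 1) = -1) := by omega
      rw [if_neg h', if_neg h]
  rw [sum_congr rfl h2, sum_ite_eq]
  split_ifs with hN
  · rfl
  · rw [Finset.mem_range, not_lt] at hN
    exact (coeff_eq_zero_of_natDegree_lt (by omega)).symm

/-- A polynomial integrates to zero around any circle (Cauchy; Mathlib's
`Complex.circleIntegral_eq_zero_of_differentiable_on_off_countable`). [cite: RhinViola2001, §3 p. 278 ("`Ĩ` vanishes if `q + h − r < 0`")] -/
theorem circleIntegral_eval_eq_zero (p : ℂ[X]) (c : ℂ) {R : ℝ} (hR : 0 ≤ R) :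
    (∮ z in C(c, R), p.eval z) = 0 :=
  Complex.circleIntegral_eq_zero_of_differentiable_on_off_countable hR countable_empty
    (p.continuous.continuousOn) (fun _ _ => p.differentiable.differentiableAt)

/-- A polynomial times a non-negative power of `(z − c)` integrates to zero (the case "`Ĩ` vanishes if
`q + h − r < 0`" of the printed proof, p. 278: the integrand is then a polynomial in `z`).
[cite: RhinViola2001, §3 p. 278 (proof of Theorem 3.1, "`Ĩ` vanishes if `q + h − r < 0`")] -/
theorem circleIntegral_eval_mul_zpow_eq_zero (p : ℂ[X]) (c : ℂ) {R : ℝ} (hR : 0 ≤ R) {n : ℤ} (hn : 0 ≤ n) :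
    (∮ z in C(c, R), p.eval z * (z - c) ^ n) = 0 := by
  obtain ⟨m, rfl⟩ := Int.eq_ofNat_of_zero_le hn
  have h : ∀ z : ℂ, p.eval z * (z - c) ^ (m : ℤ) = (p * (X - Polynomial.C c) ^ m).eval z := by
    intro z
    rw [zpow_natCast, eval_mul, eval_pow, eval_sub, eval_X, eval_C]
  simp_rw [h]
  exact circleIntegral_eval_eq_zero _ c hR

/-! ### The Taylor coefficients of `X^j (1 − X)^q` -/

/-- `taylor c (1 − X) = −(X + C (c − 1))` (plumbing). [folklore] -/
private theorem taylor_one_sub_X (c : ℂ) : taylor c (1 - X : ℂ[X]) = -(X + Polynomial.C (c - 1)) := by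
  rw [map_sub, taylor_one, taylor_X, map_sub, Polynomial.C_1]
  ring

/-- The coefficients of `(−(X + C (c−1)))^q`: `C(q,b) (−1)^b (1−c)^{q−b}` (plumbing, from Mathlib's
`coeff_X_add_C_pow`). [folklore] -/
private theorem coeff_neg_X_add_C_pow (c : ℂ) (q b : ℕ) :
    ((-(X + Polynomial.C (c - 1))) ^ q).coeff b = (q.choose b : ℂ) * (-1) ^ b * (1 - c) ^ (q - b) := by
  rw [neg_pow, ← Polynomial.C_1, ← Polynomial.C_neg, ← Polynomial.C_pow, coeff_C_mul, coeff_X_add_C_pow]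
  by_cases hb : b ≤ q
  · obtain ⟨t, rfl⟩ := Nat.exists_eq_add_of_le hb
    rw [Nat.add_sub_cancel_left, pow_add]
    have : ((-1 : ℂ) ^ t) * (c - 1) ^ t = (1 - c) ^ t := by
      rw [← mul_pow]; congr 1; ring
    calc (-1 : ℂ) ^ b * (-1) ^ t * ((c - 1) ^ t * ((b + t).choose b : ℂ))
        = ((b + t).choose b : ℂ) * (-1) ^ b * ((-1) ^ t * (c - 1) ^ t) := by ring
      _ = ((b + t).choose b : ℂ) * (-1) ^ b * (1 - c) ^ t := by rw [this]
  · rw [Nat.choose_eq_zero_of_lt (by omega)]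
    simp

/-- **The Taylor coefficients of `X^j (1−X)^q` at `c`**: the `N`-th one is the binomial convolution
`Σ_{(a,b) : a+b=N} C(j,a) c^{j−a} · C(q,b) (−1)^b (1−c)^{q−b}` — these are the coefficients that the three
residues of the printed contour integral (3.1) produce. [folklore] -/
private theorem taylor_coeff_X_pow_mul_one_sub_X_pow (c : ℂ) (j q N : ℕ) :
    (taylor c ((X : ℂ[X]) ^ j * (1 - X) ^ q)).coeff N =
      ∑ x ∈ antidiagonal N, ((j.choose x.1 : ℂ) * c ^ (j - x.1)) *
        ((q.choose x.2 : ℂ) * (-1) ^ x.2 * (1 - c) ^ (q - x.2)) := by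
  rw [taylor_mul, taylor_pow, taylor_pow, taylor_X, taylor_one_sub_X, coeff_mul]
  refine sum_congr rfl fun x _ => ?_
  rw [coeff_X_add_C_pow, coeff_neg_X_add_C_pow]
  ring

/-- The polynomial `X^j (1−X)^q` evaluates to `z^j (1−z)^q` (plumbing). [folklore] -/
private theorem eval_X_pow_mul_one_sub_X_pow (j q : ℕ) (z : ℂ) :
    ((X : ℂ[X]) ^ j * (1 - X) ^ q).eval z = z ^ j * (1 - z) ^ q := by
  rw [eval_mul, eval_pow, eval_pow, eval_X, eval_sub, eval_one, eval_X]

/-- **The one-variable residue used at every level**: for `j, q, N ∈ ℕ`, a centre `c` and `R > 0`,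
`∮_{|z−c|=R} z^j (1−z)^q (z−c)^{−(N+1)} dz = 2πi · Σ_{a+b=N} C(j,a) c^{j−a} C(q,b) (−1)^b (1−c)^{q−b}`.
[cite: RhinViola2001, §3 (3.1), (3.9)–(3.10) pp. 276–279] -/
theorem circleIntegral_pow_mul_one_sub_pow_mul_zpow_negSucc (j q N : ℕ) (c : ℂ) {R : ℝ} (hR : 0 < R) :
    (∮ z in C(c, R), z ^ j * (1 - z) ^ q * (z - c) ^ (-((N : ℤ) + 1))) =
      2 * Real.pi * I * ∑ x ∈ antidiagonal N, ((j.choose x.1 : ℂ) * c ^ (j - x.1)) *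
        ((q.choose x.2 : ℂ) * (-1) ^ x.2 * (1 - c) ^ (q - x.2)) := by
  rw [← taylor_coeff_X_pow_mul_one_sub_X_pow, ← circleIntegral_eval_mul_zpow_negSucc _ c hR N]
  simp_rw [eval_X_pow_mul_one_sub_X_pow]

/-- The polynomial case at one level: `∮_{|z−c|=R} z^j (1−z)^q (z−c)ⁿ dz = 0` for `n ≥ 0`. [cite: RhinViola2001, §3 p. 278 ("`Ĩ` vanishes if `q + h − r < 0`")] -/
theorem circleIntegral_pow_mul_one_sub_pow_mul_zpow_eq_zero (j q : ℕ) (c : ℂ) {R : ℝ} (hR : 0 ≤ R) {n : ℤ}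
    (hn : 0 ≤ n) : (∮ z in C(c, R), z ^ j * (1 - z) ^ q * (z - c) ^ n) = 0 := by
  rw [← circleIntegral_eval_mul_zpow_eq_zero ((X : ℂ[X]) ^ j * (1 - X) ^ q) c hR hn]
  simp_rw [eval_X_pow_mul_one_sub_X_pow]

/-! ### The outermost level: centre `0`, numerator `(1 − x)^L` -/

/-- `(1 − X)^L = (−(X + C(0 − 1)))^L` (plumbing for the coefficient formula). [folklore] -/
private theorem one_sub_X_pow_eq (L : ℕ) : ((1 : ℂ[X]) - X) ^ L = (-(X + Polynomial.C ((0 : ℂ) - 1))) ^ L := by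
  congr 1
  rw [zero_sub, map_neg, Polynomial.C_1]
  ring

/-- **The residue at the outermost level**: `∮_{|x|=R} (1−x)^L x^{−(t+1)} dx = 2πi · (−1)^t C(L,t)` — the
coefficient of `x^t` in `(1−x)^L` (this is where the last binomial coefficient of the closed form of `Ĩ` and the
computation `(2πi)⁻¹ ∮ dx/x = 1` of (3.10) come from). [cite: RhinViola2001, §3 (3.9)–(3.10)] -/
theorem circleIntegral_one_sub_pow_mul_zpow_negSucc (L t : ℕ) {R : ℝ} (hR : 0 < R) :
    (∮ x in C(0, R), (1 - x) ^ L * x ^ (-((t : ℤ) + 1))) =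
      2 * Real.pi * I * ((L.choose t : ℂ) * (-1) ^ t) := by
  have h := circleIntegral_eval_mul_zpow_negSucc (((1 : ℂ[X]) - X) ^ L) 0 hR t
  simp_rw [sub_zero, eval_pow, eval_sub, eval_one, eval_X] at h
  rw [h, taylor_zero, one_sub_X_pow_eq, coeff_neg_X_add_C_pow]
  simp

/-- The polynomial case at the outermost level: `∮_{|x|=R} (1−x)^L xⁿ dx = 0` for `n ≥ 0`. [cite: RhinViola2001, §3 p. 278] -/
theorem circleIntegral_one_sub_pow_mul_zpow_eq_zero (L : ℕ) {R : ℝ} (hR : 0 ≤ R) {n : ℤ} (hn : 0 ≤ n) :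
    (∮ x in C(0, R), (1 - x) ^ L * x ^ n) = 0 := by
  have h := circleIntegral_eval_mul_zpow_eq_zero (((1 : ℂ[X]) - X) ^ L) 0 hR hn
  simp_rw [sub_zero, eval_pow, eval_sub, eval_one, eval_X] at h
  exact h

/-- The integral of the zero function over a circle vanishes (plumbing). [cite: RhinViola2001, §3 p. 278] -/
theorem circleIntegral_zero_fun (c : ℂ) (R : ℝ) : (∮ _z in C(c, R), (0 : ℂ)) = 0 := by
  simp [circleIntegral]

end Theorem31

end Literature.NumberTheory.Irrationality.RhinViola2001

end
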